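import Summits.QuantumFields.YangMills.Theorems.UnitScaleTiltHalvingP1FlatCoreCovariance
import Literature.MathematicalPhysics.QuantumFieldTheory.Balaban1983to89.BlockAveragingEMLAnalyticMean
import HarnessLib

/-!
# Line H (`BirthV10.stub_halvingStep`, stmt-QuantumFields-19200) — (M2′) (b)-row toolbox, brick (B-al-4)₁:
# ★★ ONE EFFECTIVE-GAUGE STEP IS THE CENTRE BLOCK AVERAGE OF THE GAUGE, TO SECOND ORDER
# («`exp[mean log]` is multiplicative to second order» + the frame of a gauge copy)

Cell `ym3-torus` (HUMAN RULING D-0037: YM₃ on T³ is ladder rung R3 — NOT d = 4, NOT infinite volume, NOT a mass gap, NOT the Clay problem), width seat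
`ym-ust-20520-w3` gen 9 (LEAD-H ★w5-19200 g7 WORD 10 (2)∕(3) «LEMMA B-al ≡ (N1)», WORD 17 «(b)-side = B-al + (N2) + (N3) frames»; my LOCATE «B-al-3 ∕ (b)-row —
consumer side» adb4b7327f11acc3, 19200 evidence #51, §3 (B-al-4) «frames × centre values telescope»).  `--supports stmt-QuantumFields-19200 --as helper`;
THEOREMS ONLY (0 `def`, 0 `sorry`); count-neutral; nothing here claims B-al, the (b)-row, `H42topCrossT`, (M2′), the stub, the crux or the gap.

WHY.  Down a double-bar tower `D_j` ([Balaban1985Averaging] (89)∕(97)–(100), tree ✓`Prop8ChartDoubleBar.dbarIterU`) a fine gauge map `h` acts through the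
EFFECTIVE GAUGE family `κ` of ✓`P1FlatCoreFrameLinTower.dbarIterU_gaugeActT_eq_effGauge`: `κ₀ = h`, `κ_{j+1}(y) = v((D_j)^{κ_j})(y)⁻¹ · κ_j(emb y) · v(D_j)(y)` with
the block frame `v(Y)(y) = exp[|I|⁻¹ Σ_i log Y(Γ_{ŷ,x_i})]` (✓`Prop8ChartDoubleBar.vframeU`, centre stairs `Γ_{ŷ,x_i}`, `ŷ = emb y`).  The (b)-row of the (M2′) assembly
(binder d2f54740) is, by four tree identities (LOCATE §1), a statement about `κ_k(u₁⁻¹)` for the datum's (1.29)-restricted gauge `u₁`.  THIS FILE is the one-step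
analytic core of the comparison «`κ_k(h)` ≈ the `k`-fold block average of `h`»:
* §0 ★ `norm_eml_mul_sub_mul_le` — for tuples `H, D` near the identity tuple, `‖eml (H·D) − eml H · eml D‖ ≤ 1024·‖H − 1‖·‖D − 1‖`: the exp-mean-log
  (✓`ExpMeanLog.eml`) is MULTIPLICATIVE TO SECOND ORDER, the defect vanishing on both axes (`eml (1·D) = eml D`, `eml (H·1) = eml H`; EXACT whenever either
  family is trivial).  Proof: the defect `Ψ_D(U) := eml (U·D) − eml U · eml D` vanishes at `U = 1`, is `ℂ`-differentiable on the polydisc `‖U − 1‖ < 1∕8` and is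
  bounded there by `32‖D − 1‖` (Lipschitz bound ✓`BlockAveragingEMLAnalyticMean.norm_eml_add_sub_eml_le`), so the first-order Cauchy estimate along the segment
  ✓`B7TransferAnalyticMean.norm_sub_le_of_line` gives `‖Ψ_D(H)‖ ≤ 4·(32‖D − 1‖)·‖H − 1‖∕(1∕8)`.
* §1 ★ `vframeU_gaugeActT_eq_conj_eml` — EXACT: `v(Y^{u})(y) = u(ŷ) · eml{Y(Γ_{ŷ,x_i}) · u(x_i)⁻¹u(ŷ)} · u(ŷ)⁻¹` (✓`Prop8Chart.holT_gaugeActT` + (0.6)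
  ✓`ExpMeanLog.eml_conj`; generalises ✓`P1FlatCoreCovariance.vframeU_gaugeActT_of_stairConst`, the case `u(x_i) = u(ŷ)`).
* §2 ★★ `norm_effGaugeStep_sub_le` — THE STEP: with `H_i := Y(Γ_{ŷ,x_i})`, `D_i := u(x_i)⁻¹u(ŷ)` (the inverse oscillation of `u` over the block),
  `‖h‖ := max_i ‖H_i − 1‖ ≤ 1∕32`, `max_i ‖D_i − 1‖ ≤ 1∕28`:
  `‖u(ŷ)⁻¹ · [v(Y^{u})(y)⁻¹ · u(ŷ) · v(Y)(y)] · eml{D_i} − 1‖ ≤ 2·1024·‖H − 1‖·‖D − 1‖`,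
  i.e. the effective-gauge step `κ′(y) = v(Y^{κ})(y)⁻¹ κ(ŷ) v(Y)(y)` equals the CENTRE BLOCK AVERAGE `κ(ŷ)·eml{κ(ŷ)⁻¹κ(x_i)}` of the gauge up to a factor
  `1 + O(‖h‖·osc)` — EXACTLY equal on a flat tower (`H = 1`), and with NO pure `osc²` term.
CURRENCY (LOCATE §2).  The product `‖h‖·osc` is the only second-order term: with `‖h‖` in the (allowed) `s`∕local currency and `osc(u₁)` geometric in the level,
the `k`-fold sum is pointwise and k-uniform — the shape LEAD-H WORD 10 (3) can pay.  The k-step iteration, the corner∕centre dictionary to lit's (79)–(80)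
`B7Eq84Concrete.uavg` and the (1.29) reading (✓`uavg_succ_eq_one_of_restr129_box`) are the next bricks; this file is their common step.
HONEST SCOPE.  Elementary analysis over the tree's analytic-mean engine (b07) and exact covariance identities; nothing of Prop. 3∕4, Theorem 4, (M2′) or the
stub is proved here.

References: T. Bałaban, CMP **98** (1985) 17–51 [Balaban1985Averaging] ((11) p.19, (84) p.30, (89) p.31, (97)–(100) p.32, (110) p.34); CMP **109** (1987) 249–301
[Balaban1987RG1] ((0.4)–(0.8) p.253).
-/

set_option autoImplicit false

noncomputable section

open scoped BigOperators
open NormedSpace Metric Set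

namespace Summit.QuantumFields.YangMills.Theorems.HalvingEffGaugeStepBlockMean

open Literature.MathematicalPhysics.QuantumFieldTheory.Balaban1983to89
open T4Continuum BlockAveraging ExpMeanLog MatrixLog
open B7TransferAnalyticMean (norm_sub_le_of_line IsAnalyticMean)
open BlockAveragingEMLAnalyticMean (isAnalyticMean_eml norm_eml_add_sub_eml_le eml_one)
open B10Eq27TorusAxialLog (holT gaugeActT gaugeActT_apply)
open Summit.QuantumFields.YangMills.Theorems.Prop8Chart (holT_gaugeActT)
open Summit.QuantumFields.YangMills.Theorems.Prop8ChartDoubleBar (vframeU coe_vframeU)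
open B7Prop1Explicit (U1 mem_U1 norm_inv_sub_one_le)

/-! ## §0 `exp[mean log]` is multiplicative to second order -/

section EML

variable {ι : Type*} [Fintype ι] [Nonempty ι] {𝔸 : Type*} [NormedRing 𝔸] [NormedAlgebra ℂ 𝔸] [CompleteSpace 𝔸] [NormOneClass 𝔸]

omit [NormedAlgebra ℂ 𝔸] [CompleteSpace 𝔸] in
/-- A tuple within `ρ` of the identity tuple has sup norm at most `1 + ρ`. [folklore] -/
theorem norm_le_one_add_of_norm_sub_one_le {U : ι → 𝔸} {ρ : ℝ} (hU : ‖U - 1‖ ≤ ρ) : ‖U‖ ≤ 1 + ρ := by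
  calc ‖U‖ = ‖(U - 1) + 1‖ := by rw [sub_add_cancel]
    _ ≤ ‖U - 1‖ + ‖(1 : ι → 𝔸)‖ := norm_add_le _ _
    _ ≤ ρ + 1 := by rw [norm_one]; exact add_le_add hU le_rfl
    _ = 1 + ρ := add_comm _ _

omit [Nonempty ι] [NormedAlgebra ℂ 𝔸] [CompleteSpace 𝔸] [NormOneClass 𝔸] in
/-- `‖U·D − U‖ ≤ ‖U‖·‖D − 1‖` for tuples (pointwise product). [folklore] -/
theorem norm_mul_sub_self_le (U D : ι → 𝔸) : ‖U * D - U‖ ≤ ‖U‖ * ‖D - 1‖ := by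
  have h : U * D - U = U * (D - 1) := by rw [mul_sub, mul_one]
  rw [h]
  exact norm_mul_le _ _

omit [NormedAlgebra ℂ 𝔸] [CompleteSpace 𝔸] in
/-- The product of a tuple within `ρ` of the identity with a tuple `D` is within `ρ + (1 + ρ)‖D − 1‖` of the identity:
`‖U·D − 1‖ ≤ ρ + (1 + ρ)·‖D − 1‖`. [folklore] -/
theorem norm_mul_sub_one_le {U D : ι → 𝔸} {ρ : ℝ} (hU : ‖U - 1‖ ≤ ρ) :
    ‖U * D - 1‖ ≤ ρ + (1 + ρ) * ‖D - 1‖ := by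
  calc ‖U * D - 1‖ = ‖(U * D - U) + (U - 1)‖ := by rw [sub_add_sub_cancel]
    _ ≤ ‖U * D - U‖ + ‖U - 1‖ := norm_add_le _ _
    _ ≤ ‖U‖ * ‖D - 1‖ + ρ := add_le_add (norm_mul_sub_self_le U D) hU
    _ ≤ (1 + ρ) * ‖D - 1‖ + ρ := by
        have := norm_le_one_add_of_norm_sub_one_le hU
        gcongr
    _ = ρ + (1 + ρ) * ‖D - 1‖ := add_comm _ _

/-- **FIRST ORDER: the multiplicativity defect is `O(‖D − 1‖)` uniformly on the polydisc** `‖U − 1‖ ≤ 1∕6`: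
`‖eml (U·D) − eml U · eml D‖ ≤ 32·‖D − 1‖` for `‖D − 1‖ ≤ 1∕28` (Lipschitz bound `L_M = 12` of the analytic-mean engine twice, `‖eml U‖ ≤ 3∕2`). [folklore] -/
theorem norm_eml_mul_sub_mul_le_first {U D : ι → 𝔸} (hU : ‖U - 1‖ ≤ 1 / 6) (hD : ‖D - 1‖ ≤ 1 / 28) :
    ‖eml (U * D) - eml U * eml D‖ ≤ 32 * ‖D - 1‖ := by
  have hU1 : ‖U‖ ≤ 1 + 1 / 6 := norm_le_one_add_of_norm_sub_one_le hU
  have hD0 : 0 ≤ ‖D - 1‖ := norm_nonneg _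
  -- `eml (U·D) − eml U`: Lipschitz at `U` in the direction `U·(D − 1)`
  have hV : ‖U * D - U‖ ≤ 1 / 24 := by
    calc ‖U * D - U‖ ≤ ‖U‖ * ‖D - 1‖ := norm_mul_sub_self_le U D
      _ ≤ (1 + 1 / 6) * (1 / 28) := by gcongr
      _ = 1 / 24 := by norm_num
  have h1 : ‖eml (U * D) - eml U‖ ≤ 12 * (‖U‖ * ‖D - 1‖) := by
    have h := norm_eml_add_sub_eml_le (U := U) (V := U * D - U) hU hV
    rw [add_sub_cancel] at h
    exact h.trans (by gcongr; exact norm_mul_sub_self_le U D)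
  -- `eml U · eml D − eml U`: `‖eml U‖ ≤ 3∕2`, `‖eml D − 1‖ ≤ 12‖D − 1‖`
  have hK : ‖eml U - 1‖ ≤ 1 / 2 := by
    refine (isAnalyticMean_eml (ι := ι) (𝔸 := 𝔸)).norm_sub_one_le U ?_
    rw [mem_ball, dist_eq_norm]; linarith
  have hemlU : ‖eml U‖ ≤ 3 / 2 := by
    calc ‖eml U‖ = ‖(eml U - 1) + 1‖ := by rw [sub_add_cancel]
      _ ≤ ‖eml U - 1‖ + ‖(1 : 𝔸)‖ := norm_add_le _ _
      _ ≤ 1 / 2 + 1 := by rw [norm_one]; exact add_le_add hK le_rfl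
      _ = 3 / 2 := by norm_num
  have hemlD : ‖eml D - 1‖ ≤ 12 * ‖D - 1‖ := by
    have h := norm_eml_add_sub_eml_le (U := (1 : ι → 𝔸)) (V := D - 1) (by rw [sub_self, norm_zero]; norm_num) (by linarith)
    rwa [add_sub_cancel, eml_one] at h
  have h2 : ‖eml U * eml D - eml U‖ ≤ 3 / 2 * (12 * ‖D - 1‖) := by
    have h : eml U * eml D - eml U = eml U * (eml D - 1) := by rw [mul_sub, mul_one]
    rw [h]
    exact (norm_mul_le _ _).trans (by gcongr)
  calc ‖eml (U * D) - eml U * eml D‖ = ‖(eml (U * D) - eml U) - (eml U * eml D - eml U)‖ := by rw [sub_sub_sub_cancel_right]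
    _ ≤ ‖eml (U * D) - eml U‖ + ‖eml U * eml D - eml U‖ := norm_sub_le _ _
    _ ≤ 12 * (‖U‖ * ‖D - 1‖) + 3 / 2 * (12 * ‖D - 1‖) := add_le_add h1 h2
    _ ≤ 12 * ((1 + 1 / 6) * ‖D - 1‖) + 3 / 2 * (12 * ‖D - 1‖) := by gcongr
    _ = 32 * ‖D - 1‖ := by ring

/-- The defect functional `U ↦ eml (U·D) − eml U · eml D` is `ℂ`-differentiable on the polydisc `‖U − 1‖ < 1∕8` (`eml` is analytic on `‖· − 1‖ < 1∕3`,
✓`BlockAveragingEMLAnalyticMean.isAnalyticMean_eml`). [folklore] -/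
theorem differentiableOn_defect {D : ι → 𝔸} (hD : ‖D - 1‖ ≤ 1 / 28) :
    DifferentiableOn ℂ (fun U : ι → 𝔸 => eml (U * D) - eml U * eml D) (ball (1 : ι → 𝔸) (1 / 8)) := by
  have hA := (isAnalyticMean_eml (ι := ι) (𝔸 := 𝔸)).analyticOnNhd
  intro U hU
  have hU' : ‖U - 1‖ < 1 / 8 := by rwa [mem_ball, dist_eq_norm] at hU
  have hUD : U * D ∈ ball (1 : ι → 𝔸) (1 / 3) := by
    rw [mem_ball, dist_eq_norm]
    have h := norm_mul_sub_one_le (D := D) hU'.le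
    have : (1 : ℝ) / 8 + (1 + 1 / 8) * ‖D - 1‖ < 1 / 3 := by nlinarith
    exact lt_of_le_of_lt h this
  have hU3 : U ∈ ball (1 : ι → 𝔸) (1 / 3) := by
    rw [mem_ball, dist_eq_norm]; linarith
  have h1 : DifferentiableAt ℂ (fun V : ι → 𝔸 => eml (V * D)) U := by
    have hm : DifferentiableAt ℂ (fun V : ι → 𝔸 => V * D) U := differentiableAt_id.mul (differentiableAt_const D)
    exact ((hA (U * D) hUD).differentiableAt).comp U hm
  have h2 : DifferentiableAt ℂ (fun V : ι → 𝔸 => eml V * eml D) U :=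
    ((hA U hU3).differentiableAt).mul (differentiableAt_const _)
  exact (h1.sub h2).differentiableWithinAt

/-- ★ **`exp[mean log]` IS MULTIPLICATIVE TO SECOND ORDER**: for tuples `H, D : ι → 𝔸` with `‖H − 1‖ ≤ 1∕32`, `‖D − 1‖ ≤ 1∕28`,
`‖eml (H·D) − eml H · eml D‖ ≤ 1024 · ‖H − 1‖ · ‖D − 1‖` — the defect vanishes on both axes, so the first-order Cauchy estimate along the segment from the
identity tuple to `H` (✓`B7TransferAnalyticMean.norm_sub_le_of_line`, radius `1∕8`, bound `32‖D − 1‖` of `norm_eml_mul_sub_mul_le_first`) is quadratic.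
(Print: the averaging operation is analytic near the identity tuple with `M(1) = 1`, `DM(1) =` the mean, [Balaban1987RG1] (0.5)–(0.8).) [cite: Balaban1987RG1, (0.5)-(0.8) p.253] -/
theorem norm_eml_mul_sub_mul_le {H D : ι → 𝔸} (hH : ‖H - 1‖ ≤ 1 / 32) (hD : ‖D - 1‖ ≤ 1 / 28) :
    ‖eml (H * D) - eml H * eml D‖ ≤ 1024 * ‖H - 1‖ * ‖D - 1‖ := by
  set Φ : (ι → 𝔸) → 𝔸 := fun U => eml (U * D) - eml U * eml D with hΦ
  have hdiff : DifferentiableOn ℂ Φ (ball (1 : ι → 𝔸) (1 / 8)) := differentiableOn_defect hD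
  have hB : ∀ U ∈ ball (1 : ι → 𝔸) (1 / 8), ‖Φ U‖ ≤ 32 * ‖D - 1‖ := by
    intro U hU
    have hU' : ‖U - 1‖ < 1 / 8 := by rwa [mem_ball, dist_eq_norm] at hU
    exact norm_eml_mul_sub_mul_le_first (by linarith) hD
  have h1 : (1 : ι → 𝔸) ∈ ball (1 : ι → 𝔸) (1 / 8) := mem_ball_self (by norm_num)
  have hv : 4 * ‖H - 1‖ ≤ 1 / 8 - ‖(1 : ι → 𝔸) - 1‖ := by rw [sub_self, norm_zero, sub_zero]; linarith
  have h := norm_sub_le_of_line hdiff hB h1 hv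
  have hΦ1 : Φ 1 = 0 := by
    simp only [hΦ, one_mul, eml_one, sub_self]
  rw [add_sub_cancel, hΦ1, sub_zero, sub_self, norm_zero, sub_zero] at h
  calc ‖eml (H * D) - eml H * eml D‖ = ‖Φ H‖ := rfl
    _ ≤ 4 * (32 * ‖D - 1‖) * ‖H - 1‖ / (1 / 8) := h
    _ = 1024 * ‖H - 1‖ * ‖D - 1‖ := by ring

end EML

/-! ## §1 The frame of a gauge copy, exactly -/

section Frame

variable {P : Params} {j : ℕ} {𝔸 : Type*} [NormedRing 𝔸] [NormedAlgebra ℂ 𝔸] [CompleteSpace 𝔸]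

/-- ★ **THE FRAME OF A GAUGE COPY, EXACTLY**: `v(Y^{u})(y) = u(ŷ) · eml{ Y(Γ_{ŷ,x_i}) · (u(x_i)⁻¹ u(ŷ)) } · u(ŷ)⁻¹` — every centre stair of `Y^{u}` transports as
`u(ŷ)·Y(Γ)·u(x_i)⁻¹` (✓`Prop8Chart.holT_gaugeActT`), and `exp[mean log]` commutes with conjugation ((0.6), ✓`ExpMeanLog.eml_conj`).  The stair-constant case
`u(x_i) = u(ŷ)` is ✓`P1FlatCoreCovariance.vframeU_gaugeActT_of_stairConst`. [cite: Balaban1985Averaging, (110) p.34, (8)-(9) pp.18-19; Balaban1987RG1, (0.6) p.253] -/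
theorem coe_vframeU_gaugeActT_eq_conj_eml (u : GaugeTransf P j 𝔸ˣ) (W : GaugeField P j 𝔸ˣ) (y : Site P (j + 1)) :
    ((vframeU (gaugeActT u W) y : 𝔸ˣ) : 𝔸) =
      ((u (emb y) : 𝔸ˣ) : 𝔸) *
        eml (fun i : Idx P => ((holT W (emb y) (stairWord i.2.1 (off i.1)) : 𝔸ˣ) : 𝔸) * ((((u (walkEnd (emb y) (stairWord i.2.1 (off i.1))))⁻¹ * u (emb y)) : 𝔸ˣ) : 𝔸)) *
        (((u (emb y))⁻¹ : 𝔸ˣ) : 𝔸) := by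
  rw [coe_vframeU]
  have hfam : (fun i : Idx P => ((holT (gaugeActT u W) (emb y) (stairWord i.2.1 (off i.1)) : 𝔸ˣ) : 𝔸)) =
      fun i => ((u (emb y) : 𝔸ˣ) : 𝔸) * (((holT W (emb y) (stairWord i.2.1 (off i.1)) : 𝔸ˣ) : 𝔸) * ((((u (walkEnd (emb y) (stairWord i.2.1 (off i.1))))⁻¹ * u (emb y)) : 𝔸ˣ) : 𝔸)) * (((u (emb y))⁻¹ : 𝔸ˣ) : 𝔸) := by
    funext i
    rw [holT_gaugeActT, Units.val_mul, Units.val_mul, Units.val_mul]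
    simp only [mul_assoc, Units.mul_inv, mul_one]
  rw [hfam, eml_conj (Units.mul_inv _) (Units.inv_mul _)]

end Frame

/-! ## §2 The effective-gauge step is the centre block average of the gauge, to second order -/

section Step

variable {P : Params} {j : ℕ} {𝔸 : Type*} [NormedRing 𝔸] [NormedAlgebra ℂ 𝔸] [CompleteSpace 𝔸] [NormOneClass 𝔸]

omit [NormedAlgebra ℂ 𝔸] [CompleteSpace 𝔸] [NormOneClass 𝔸] in
/-- sup norm of a tuple from pointwise bounds. [folklore] -/
theorem pi_norm_sub_one_le {F : Idx P → 𝔸} {r : ℝ} (hr : 0 ≤ r) (h : ∀ i, ‖F i - 1‖ ≤ r) : ‖F - 1‖ ≤ r :=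
  (pi_norm_le_iff_of_nonneg hr).2 fun i => by simpa only [Pi.sub_apply, Pi.one_apply] using h i

/-- ★★ **ONE EFFECTIVE-GAUGE STEP = THE CENTRE BLOCK AVERAGE OF THE GAUGE, TO SECOND ORDER.**  For a `U1`-valued gauge map `u` and a field `Y` whose centre
stairs `H_i := Y(Γ_{ŷ,x_i})` lie in `U1` with `‖H_i − 1‖ ≤ h ≤ 1∕64`, and block oscillation `D_i := u(x_i)⁻¹u(ŷ)`, `‖D_i − 1‖ ≤ e ≤ 1∕64`:
`‖ u(ŷ)⁻¹ · [v(Y^{u})(y)⁻¹ · u(ŷ) · v(Y)(y)] · eml{D_i} − 1 ‖ ≤ 1536·h·e`: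
the step `κ′(y) = v(Y^{κ})(y)⁻¹ κ(ŷ) v(Y)(y)` of the effective-gauge recursion (✓`P1FlatCoreFrameLinTower.dbarIterU_gaugeActT_eq_effGauge`) is the centre block
average `κ(ŷ) · eml{κ(ŷ)⁻¹κ(x_i)} = κ(ŷ) · (eml{D_i})⁻¹` up to a factor `1 + O(h·e)`; EXACT on a flat block (`H = 1`), no pure `e²` term.
[cite: Balaban1985Averaging, (110) p.34, (84) p.30, (89) p.31; Balaban1987RG1, (0.5)-(0.8) p.253] -/
theorem norm_effGaugeStep_mul_eml_sub_one_le (u : GaugeTransf P j 𝔸ˣ) (W : GaugeField P j 𝔸ˣ) (y : Site P (j + 1))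
    (hu : ∀ x, u x ∈ U1 𝔸) (hH : ∀ i : Idx P, holT W (emb y) (stairWord i.2.1 (off i.1)) ∈ U1 𝔸) {h e : ℝ} (h0 : 0 ≤ h) (e0 : 0 ≤ e)
    (hh : ∀ i : Idx P, ‖((holT W (emb y) (stairWord i.2.1 (off i.1)) : 𝔸ˣ) : 𝔸) - 1‖ ≤ h)
    (he : ∀ i : Idx P, ‖((((u (walkEnd (emb y) (stairWord i.2.1 (off i.1))))⁻¹ * u (emb y)) : 𝔸ˣ) : 𝔸) - 1‖ ≤ e)
    (hh0 : h ≤ 1 / 64) (he0 : e ≤ 1 / 64) :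
    ‖(((u (emb y))⁻¹ * ((vframeU (gaugeActT u W) y)⁻¹ * u (emb y) * vframeU W y) : 𝔸ˣ) : 𝔸) *
        eml (fun i : Idx P => ((((u (walkEnd (emb y) (stairWord i.2.1 (off i.1))))⁻¹ * u (emb y)) : 𝔸ˣ) : 𝔸)) - 1‖ ≤ 1536 * h * e := by
  -- letters
  set Hc : Idx P → 𝔸 := fun i => ((holT W (emb y) (stairWord i.2.1 (off i.1)) : 𝔸ˣ) : 𝔸) with hHc
  set Dc : Idx P → 𝔸 := fun i => ((((u (walkEnd (emb y) (stairWord i.2.1 (off i.1))))⁻¹ * u (emb y)) : 𝔸ˣ) : 𝔸) with hDc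
  set Yc : Idx P → 𝔸 := fun i => (((holT W (emb y) (stairWord i.2.1 (off i.1)) * ((u (walkEnd (emb y) (stairWord i.2.1 (off i.1))))⁻¹ * u (emb y)))⁻¹ : 𝔸ˣ) : 𝔸) with hYc
  -- sizes
  have hHn : ‖Hc - 1‖ ≤ h := pi_norm_sub_one_le h0 hh
  have hDn : ‖Dc - 1‖ ≤ e := pi_norm_sub_one_le e0 he
  have hDU : ∀ i : Idx P, ((u (walkEnd (emb y) (stairWord i.2.1 (off i.1))))⁻¹ * u (emb y)) ∈ U1 𝔸 :=
    fun i => (U1 𝔸).mul_mem ((U1 𝔸).inv_mem (hu _)) (hu _)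
  have hHD : ‖Hc * Dc - 1‖ ≤ h + e := by
    refine pi_norm_sub_one_le (by positivity) fun i => ?_
    have hDi : ‖Dc i‖ ≤ 1 := (mem_U1.mp (hDU i)).1
    calc ‖Hc i * Dc i - 1‖ = ‖(Hc i - 1) * Dc i + (Dc i - 1)‖ := by congr 1; noncomm_ring
      _ ≤ ‖Hc i - 1‖ * ‖Dc i‖ + ‖Dc i - 1‖ := (norm_add_le _ _).trans (add_le_add (norm_mul_le _ _) le_rfl)
      _ ≤ h * 1 + e := by gcongr <;> [exact hh i; exact he i]
      _ = h + e := by ring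
  -- §0: the multiplicativity defect
  have hdef : ‖eml (Hc * Dc) - eml Hc * eml Dc‖ ≤ 1024 * ‖Hc - 1‖ * ‖Dc - 1‖ :=
    norm_eml_mul_sub_mul_le (hHn.trans (by linarith)) (hDn.trans (by linarith))
  -- the inverse of `eml (Hc * Dc)` is `eml` of the inverse family, of norm ≤ 3∕2
  have hprod : ∀ i, (Hc * Dc) i * Yc i = 1 := fun i => by
    show Hc i * Dc i * Yc i = 1
    simp only [hHc, hDc, hYc]
    rw [← Units.val_mul, Units.mul_inv]
  have hsmall : ∀ i, ‖(Hc * Dc) i - 1‖ ≤ 1 / 3 := fun i =>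
    ((norm_le_pi_norm (Hc * Dc - 1) i).trans hHD).trans (by linarith)
  have hinvL : eml Yc * eml (Hc * Dc) = 1 := eml_inv_mul hprod hsmall
  have hinvR : eml (Hc * Dc) * eml Yc = 1 := eml_mul_inv hprod hsmall
  have hYn : ‖Yc - 1‖ ≤ h + e := by
    refine pi_norm_sub_one_le (by positivity) fun i => ?_
    have hU : holT W (emb y) (stairWord i.2.1 (off i.1)) * ((u (walkEnd (emb y) (stairWord i.2.1 (off i.1))))⁻¹ * u (emb y)) ∈ U1 𝔸 :=
      (U1 𝔸).mul_mem (hH i) (hDU i)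
    have h1 := norm_inv_sub_one_le hU
    rw [Units.val_mul] at h1
    exact h1.trans ((norm_le_pi_norm (Hc * Dc - 1) i).trans hHD)
  have hemlY : ‖eml Yc‖ ≤ 3 / 2 := by
    have hK : ‖eml Yc - 1‖ ≤ 1 / 2 := by
      refine (isAnalyticMean_eml (ι := Idx P) (𝔸 := 𝔸)).norm_sub_one_le Yc ?_
      rw [mem_ball, dist_eq_norm]; linarith
    calc ‖eml Yc‖ = ‖(eml Yc - 1) + 1‖ := by rw [sub_add_cancel]
      _ ≤ ‖eml Yc - 1‖ + ‖(1 : 𝔸)‖ := norm_add_le _ _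
      _ ≤ 1 / 2 + 1 := by rw [norm_one]; exact add_le_add hK le_rfl
      _ = 3 / 2 := by norm_num
  -- §1: the frame of the gauge copy and its inverse
  have hv : ((vframeU (gaugeActT u W) y : 𝔸ˣ) : 𝔸) = ((u (emb y) : 𝔸ˣ) : 𝔸) * eml (Hc * Dc) * (((u (emb y))⁻¹ : 𝔸ˣ) : 𝔸) :=
    coe_vframeU_gaugeActT_eq_conj_eml u W y
  have hvinv : (((vframeU (gaugeActT u W) y)⁻¹ : 𝔸ˣ) : 𝔸) = ((u (emb y) : 𝔸ˣ) : 𝔸) * eml Yc * (((u (emb y))⁻¹ : 𝔸ˣ) : 𝔸) := by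
    apply Units.inv_eq_of_mul_eq_one_right
    rw [hv]
    calc ((u (emb y) : 𝔸ˣ) : 𝔸) * eml (Hc * Dc) * (((u (emb y))⁻¹ : 𝔸ˣ) : 𝔸) * (((u (emb y) : 𝔸ˣ) : 𝔸) * eml Yc * (((u (emb y))⁻¹ : 𝔸ˣ) : 𝔸))
          = ((u (emb y) : 𝔸ˣ) : 𝔸) * (eml (Hc * Dc) * ((((u (emb y))⁻¹ : 𝔸ˣ) : 𝔸) * ((u (emb y) : 𝔸ˣ) : 𝔸)) * eml Yc) * (((u (emb y))⁻¹ : 𝔸ˣ) : 𝔸) := by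
            noncomm_ring
      _ = 1 := by rw [Units.inv_mul, mul_one, hinvR, mul_one, Units.mul_inv]
  -- the step in letters: `u(ŷ)⁻¹ · [v(Y^u)⁻¹ u(ŷ) v(Y)] = eml Yc · eml Hc`
  have hstep : (((u (emb y))⁻¹ * ((vframeU (gaugeActT u W) y)⁻¹ * u (emb y) * vframeU W y) : 𝔸ˣ) : 𝔸) = eml Yc * eml Hc := by
    rw [Units.val_mul, Units.val_mul, Units.val_mul, hvinv, coe_vframeU]
    calc (((u (emb y))⁻¹ : 𝔸ˣ) : 𝔸) * (((u (emb y) : 𝔸ˣ) : 𝔸) * eml Yc * (((u (emb y))⁻¹ : 𝔸ˣ) : 𝔸) * ((u (emb y) : 𝔸ˣ) : 𝔸) * eml Hc)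
          = ((((u (emb y))⁻¹ : 𝔸ˣ) : 𝔸) * ((u (emb y) : 𝔸ˣ) : 𝔸)) * eml Yc * ((((u (emb y))⁻¹ : 𝔸ˣ) : 𝔸) * ((u (emb y) : 𝔸ˣ) : 𝔸)) * eml Hc := by
            noncomm_ring
      _ = eml Yc * eml Hc := by rw [Units.inv_mul, one_mul, mul_one]
  -- conclusion: `eml Yc · (eml Hc · eml Dc − eml (Hc·Dc))`
  have hkey : eml Yc * eml Hc * eml Dc - 1 = eml Yc * (eml Hc * eml Dc - eml (Hc * Dc)) := by
    rw [mul_sub, ← mul_assoc, hinvL]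
  rw [hstep, hkey]
  calc ‖eml Yc * (eml Hc * eml Dc - eml (Hc * Dc))‖ ≤ ‖eml Yc‖ * ‖eml Hc * eml Dc - eml (Hc * Dc)‖ := norm_mul_le _ _
    _ ≤ 3 / 2 * (1024 * ‖Hc - 1‖ * ‖Dc - 1‖) := by
        rw [norm_sub_rev]; gcongr
    _ ≤ 3 / 2 * (1024 * h * e) := by gcongr
    _ = 1536 * h * e := by ring

end Step

end Summit.QuantumFields.YangMills.Theorems.HalvingEffGaugeStepBlockMean

end
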